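import Literature.Geometry.Riemannian.DistanceDirectionalData
import HarnessLib

/-!
# The spatial directional barriers for `d²` at one end of a geodesic, in the shape consumed by
# the directional minimum principle (Bamler 2020a, proof of Thm. 3.5: `Δ d² ≤ 2 + (n−1)π²/4 −
# 2d ∫ sin² Ric` in barrier form at the far end)

From the far-end datum of `DistanceDirectionalData.lean` (`far_end_directional_datum`: exact
radial barrier `d ≤ T + σ`, transverse barriers `d ≤ T + (Qₒ + εT)/2 · σ²`, trace identity) we
build, for `ψ = d(p, ·)²` at `y₀ = γ(T) = exp_p(Tu)`, an orthonormal frame indexed by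
`Fin (dim M)` and one-variable polynomial upper barriers `Bᵢ(σ) ≥ d(p, exp_{y₀}(σ eᵢ))²` near
`σ = 0`, touching (`Bᵢ(0) = T²`), with second derivatives `bᵢ` satisfying
`Σᵢ bᵢ ≤ 2 + (dim M − 1) π²/4 − 2T ∫₀ᵀ sin²(πs/2T) Ric(γ̇, γ̇) ds + ε₁`
(`end_distSq_barriers`). The radial barrier is `(T + σ)²` (`b = 2`), the transverse ones are
`T² + (2T qₒ + ε) σ²` from `(T + qₒσ²)² ≤ T² + (2Tqₒ + ε)σ²` for `σ` small.

Everything is proved; no definitions, no named facts.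

## References

* R. H. Bamler, *Entropy and heat kernel bounds on a Ricci flow background*, arXiv:2008.07093
  (2020), §3.2, proof of Thm. 3.5. [Bamler2020Entropy]
-/

noncomputable section

open Bundle Set Function Filter MeasureTheory intervalIntegral
open scoped Manifold ContDiff Topology ENNReal NNReal Real

namespace Literature.Geometry.Riemannian

open Lorentzian Lorentzian.PseudoRiemannianMetric

section EndBarriers

variable {E : Type*} [NormedAddCommGroup E] [NormedSpace ℝ E] [FiniteDimensional ℝ E]
  [CompleteSpace E] {M : Type*} [TopologicalSpace M] [ChartedSpace E M] [IsManifold 𝓘(ℝ, E) ∞ M]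
  [T2Space M]
  (g : PseudoRiemannianMetric 𝓘(ℝ, E) ∞ E (TangentSpace 𝓘(ℝ, E) : M → Type _)) [g.HasLeviCivita]
  [CovariantDerivative.ContMDiffCovariantDerivative g.leviCivita 1]
  [CovariantDerivative.ContMDiffCovariantDerivative g.leviCivita ∞]

/-- `(T + qσ²)² ≤ T² + (2Tq + ε) σ²` for `σ` near `0` (`q²σ² ≤ ε` eventually). [folklore] -/
theorem eventually_sq_add_le (T q : ℝ) {ε : ℝ} (hε : 0 < ε) :
    ∀ᶠ σ in 𝓝 (0 : ℝ), (T + q * σ ^ 2) ^ 2 ≤ T ^ 2 + (2 * T * q + ε) * σ ^ 2 := by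
  have h : Tendsto (fun σ : ℝ ↦ q ^ 2 * σ ^ 2) (𝓝 0) (𝓝 (q ^ 2 * 0 ^ 2)) :=
    (continuous_const.mul (continuous_pow 2)).tendsto 0
  rw [zero_pow two_ne_zero, mul_zero] at h
  filter_upwards [h (Iio_mem_nhds hε)] with σ hσ
  have hσ' : q ^ 2 * σ ^ 2 < ε := hσ
  nlinarith [sq_nonneg σ, sq_nonneg (q * σ ^ 2)]

/-- **Spatial directional barriers for `d(p, ·)²` at the far end `y₀ = exp_p(Tu)` of a unit speed
geodesic** (complete Riemannian manifold, `T > 0`, `ε₁ > 0`): a `g`-orthonormal frame `e` at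
`y₀` indexed by `Fin (dim M)`, polynomial upper barriers `Bᵢ(σ) ≥ d(p, exp_{y₀}(σ eᵢ))²` for `σ`
near `0` with `Bᵢ(0) = T²`, derivatives `Bᵢ′` and second derivatives `bᵢ` at `0`, and
`Σᵢ bᵢ ≤ 2 + (dim M − 1) π²/4 − 2T ∫₀ᵀ sin²(πs/2T) Ric(γ̇, γ̇) ds + ε₁`.
[cite: Bamler2020Entropy, §3.2, proof of Thm. 3.5] -/
theorem end_distSq_barriers (hg : g.IsRiemannian) (hc : IsGeodesicallyComplete g.leviCivita)
    (p : M) (u : TangentSpace 𝓘(ℝ, E) p) (hu : g.val p u u = 1) {T : ℝ} (hT : 0 < T)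
    {ε₁ : ℝ} (hε₁ : 0 < ε₁) :
    ∃ (e : Fin (Module.finrank ℝ E) → TangentSpace 𝓘(ℝ, E) (expMap g.leviCivita p (T • u)))
      (B B' : Fin (Module.finrank ℝ E) → ℝ → ℝ) (b : Fin (Module.finrank ℝ E) → ℝ),
      (∀ i j, g.val (expMap g.leviCivita p (T • u)) (e i) (e j) = if i = j then 1 else 0) ∧
      (∀ i, (∀ᶠ σ in 𝓝 (0 : ℝ), HasDerivAt (B i) (B' i σ) σ) ∧ HasDerivAt (B' i) (b i) 0 ∧
        B i 0 = T ^ 2 ∧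
        ∀ᶠ σ in 𝓝 (0 : ℝ), (g.edist hg p
          (expMap g.leviCivita (expMap g.leviCivita p (T • u)) (σ • e i))).toReal ^ 2 ≤ B i σ) ∧
      ∑ i, b i ≤ 2 + ((Module.finrank ℝ E : ℝ) - 1) * (π ^ 2 / 4) -
        2 * T * (∫ s in (0 : ℝ)..T, Real.sin (π * s / (2 * T)) ^ 2 *
            g.leviCivita.ricci (expMap g.leviCivita p (s • u))
              (velocity 𝓘(ℝ, E) (fun t ↦ expMap g.leviCivita p (t • u)) s)
              (velocity 𝓘(ℝ, E) (fun t ↦ expMap g.leviCivita p (t • u)) s)) + ε₁ := by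
  classical
  obtain ⟨k, f, Q, hcard, hon, hhead, hrad, hbar, hQ⟩ :=
    far_end_directional_datum g hg hc p u hu hT
  -- sizes
  have hk : (k : ℝ) = (Module.finrank ℝ E : ℝ) - 1 := by
    have : Fintype.card (Option (Fin k)) = k + 1 := by simp
    rw [this] at hcard
    have : ((k + 1 : ℕ) : ℝ) = (Module.finrank ℝ E : ℝ) := by exact_mod_cast hcard
    push_cast at this; linarith
  -- the inner slack
  set ε : ℝ := ε₁ / (2 * ((k : ℝ) + 1) * (T ^ 2 + 1)) with hε_def
  have hε : 0 < ε := by positivity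
  -- reindexing `Fin (dim M) ≃ Option (Fin k)`
  have hcardF : Fintype.card (Fin (Module.finrank ℝ E)) = Fintype.card (Option (Fin k)) := by
    rw [Fintype.card_fin, hcard]
  set ι : Fin (Module.finrank ℝ E) ≃ Option (Fin k) := Fintype.equivOfCardEq hcardF with hι
  -- the barriers per direction `o`
  set q : Option (Fin k) → ℝ := fun o ↦ (Q o + ε * T) / 2 with hq
  set Bq : Option (Fin k) → ℝ → ℝ := fun o σ ↦
    if o = none then (T + σ) ^ 2 else T ^ 2 + (2 * T * q o + ε) * σ ^ 2 with hBq
  set Bq' : Option (Fin k) → ℝ → ℝ := fun o σ ↦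
    if o = none then 2 * (T + σ) else 2 * (2 * T * q o + ε) * σ with hBq'
  set bq : Option (Fin k) → ℝ := fun o ↦ if o = none then 2 else 2 * (2 * T * q o + ε) with hbq
  have hBd : ∀ o σ, HasDerivAt (Bq o) (Bq' o σ) σ := by
    intro o σ
    by_cases ho : o = none
    · have h1 : HasDerivAt (fun x : ℝ ↦ (T + x) ^ 2) (2 * (T + σ)) σ :=
        ((hasDerivAt_pow 2 (T + σ)).comp σ ((hasDerivAt_id' σ).const_add T)).congr_deriv (by ring)
      have e1 : Bq o = fun x : ℝ ↦ (T + x) ^ 2 := by funext x; simp [hBq, ho]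
      have e2 : Bq' o σ = 2 * (T + σ) := by simp [hBq', ho]
      rw [e1, e2]; exact h1
    · have h1 : HasDerivAt (fun x : ℝ ↦ T ^ 2 + (2 * T * q o + ε) * x ^ 2)
          (2 * (2 * T * q o + ε) * σ) σ :=
        (((hasDerivAt_pow 2 σ).const_mul (2 * T * q o + ε)).const_add (T ^ 2)).congr_deriv (by ring)
      have e1 : Bq o = fun x : ℝ ↦ T ^ 2 + (2 * T * q o + ε) * x ^ 2 := by funext x; simp [hBq, ho]
      have e2 : Bq' o σ = 2 * (2 * T * q o + ε) * σ := by simp [hBq', ho]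
      rw [e1, e2]; exact h1
  have hB'd : ∀ o, HasDerivAt (Bq' o) (bq o) 0 := by
    intro o
    by_cases ho : o = none
    · have h1 : HasDerivAt (fun x : ℝ ↦ 2 * (T + x)) 2 0 :=
        (((hasDerivAt_id' (0 : ℝ)).const_add T).const_mul 2).congr_deriv (by ring)
      have e1 : Bq' o = fun x : ℝ ↦ 2 * (T + x) := by funext x; simp [hBq', ho]
      have e2 : bq o = 2 := by simp [hbq, ho]
      rw [e1, e2]; exact h1
    · have h1 : HasDerivAt (fun x : ℝ ↦ 2 * (2 * T * q o + ε) * x) (2 * (2 * T * q o + ε)) 0 :=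
        ((hasDerivAt_id' (0 : ℝ)).const_mul (2 * (2 * T * q o + ε))).congr_deriv (by ring)
      have e1 : Bq' o = fun x : ℝ ↦ 2 * (2 * T * q o + ε) * x := by funext x; simp [hBq', ho]
      have e2 : bq o = 2 * (2 * T * q o + ε) := by simp [hbq, ho]
      rw [e1, e2]; exact h1
  have hB0 : ∀ o, Bq o 0 = T ^ 2 := by
    intro o; by_cases ho : o = none <;> simp [hBq, ho]
  -- domination
  have hdom : ∀ o, ∀ᶠ σ in 𝓝 (0 : ℝ), (g.edist hg p
      (expMap g.leviCivita (expMap g.leviCivita p (T • u)) (σ • f o))).toReal ^ 2 ≤ Bq o σ := by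
    intro o
    by_cases ho : o = none
    · subst ho
      filter_upwards [Ioo_mem_nhds (show -T < 0 by linarith) hT] with σ hσ
      simp only [hBq, if_true]
      exact pow_le_pow_left₀ ENNReal.toReal_nonneg (hrad σ hσ) 2
    · filter_upwards [hbar o ε hε, eventually_sq_add_le T (q o) hε] with σ h1 h2
      simp only [ho, if_false, add_zero] at h1
      simp only [hBq, ho, if_false]
      have h0 : 0 ≤ (g.edist hg p (expMap g.leviCivita (expMap g.leviCivita p (T • u)) (σ • f o))).toReal :=
        ENNReal.toReal_nonneg
      have h3 : (g.edist hg p (expMap g.leviCivita (expMap g.leviCivita p (T • u)) (σ • f o))).toReal ^ 2 ≤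
          (T + q o * σ ^ 2) ^ 2 := pow_le_pow_left₀ h0 (by simpa [hq] using h1) 2
      exact h3.trans h2
  -- the sum of the second derivatives
  have hsumb : ∑ o, bq o = 2 + 2 * T * ((∑ o, Q o) - Q none) + (k : ℝ) * (2 * ε * T ^ 2 + 2 * ε) := by
    rw [Fintype.sum_option, Fintype.sum_option]
    simp only [hbq, if_true, Option.some_ne_none, if_false, hq]
    rw [show ∑ x : Fin k, 2 * (2 * T * ((Q (some x) + ε * T) / 2) + ε) =
        ∑ x : Fin k, (2 * T * Q (some x) + (2 * ε * T ^ 2 + 2 * ε)) from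
      Finset.sum_congr rfl fun x _ ↦ by ring, Finset.sum_add_distrib, Finset.sum_const,
      Finset.card_univ, Fintype.card_fin, nsmul_eq_mul, ← Finset.mul_sum]
    ring
  have hslack : (k : ℝ) * (2 * ε * T ^ 2 + 2 * ε) ≤ ε₁ := by
    have hk0 : 0 ≤ (k : ℝ) := Nat.cast_nonneg k
    have e1 : (k : ℝ) * (2 * ε * T ^ 2 + 2 * ε) = ε₁ * ((k : ℝ) / ((k : ℝ) + 1)) := by
      rw [hε_def]; field_simp
    rw [e1]
    have h2 : (k : ℝ) / ((k : ℝ) + 1) ≤ 1 := by rw [div_le_one (by positivity)]; linarith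
    nlinarith
  -- assembly
  refine ⟨fun i ↦ f (ι i), fun i ↦ Bq (ι i), fun i ↦ Bq' (ι i), fun i ↦ bq (ι i),
    fun i j ↦ ?_, fun i ↦ ⟨Eventually.of_forall fun σ ↦ hBd _ σ, hB'd _, hB0 _, hdom _⟩, ?_⟩
  · simp only [hon, EmbeddingLike.apply_eq_iff_eq]
  · rw [Fintype.sum_equiv ι (fun i ↦ bq (ι i)) bq (fun i ↦ rfl), hsumb, hQ]
    rw [hk] at hslack ⊢
    have e : 2 * T * (((Module.finrank ℝ E : ℝ) - 1) * (π ^ 2 / (8 * T))) =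
        ((Module.finrank ℝ E : ℝ) - 1) * (π ^ 2 / 4) := by
      field_simp; ring
    linarith [e, hslack]

end EndBarriers

end Literature.Geometry.Riemannian

end
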